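import Summits.QuantumFields.YangMills.Theorems.F4SubCurvatureDoorPlanarLaplaceFourier
import Literature.Analysis.Complex.HolomorphicParametricIntegral
import Mathlib
import HarnessLib

/-!
# LINE g20-A «angular type» — rung R0 `PlanarFrameTimeHolomorphy` BY NAME (⟨stmt-QuantumFields-23035⟩)

Crux `F4SubCurvatureDoor.ShortRootRigidity` ⟨stmt-QuantumFields-23035⟩, registered skeleton `Cruxes/ShortRootRigidity/Lines/angular_type.lean`,
owner rung file `Cruxes/ShortRootRigidity/Lines/angular_type_rungs.lean` (ns `…Cruxes.ShortRootRigidity.AngularTypeRungs`, stamped by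
idea-crit-4).  This file restates `mk2` and R0 `PlanarFrameTimeHolomorphy` CHARACTER-IDENTICALLY (`E2`, `InPlanarClass` are the registered
copies in `…SliceDensityRegistered` / `…SliceInClassRegistered`) and PROVES `planarFrameTimeHolomorphy : PlanarFrameTimeHolomorphy`:
complex translation along the frame-`0` time axis — for `k ∈ InPlanarClass` and `y₀ ≠ 0`, `u ↦ k(y₀ + u, y₁)` is on `(-|y₀|, |y₀|)` the
trace of a function holomorphic on the disc of radius `|y₀|`, bounded there by the axis value `k(y₀ + Re w, 0)`.

PROOF (the one-mirror OS lemma through the planar Laplace–Fourier measure).  By `…PlanarLaplaceFourier.exists_planarLF` (the tree's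
Berg–Christensen–Ressel theorem for `V = ℝ`; budget-free, `μ` possibly infinite) `k(t, x) = ∫ e^{-tE} cos(px) dμ(E, p)` for `t > 0` with
`∫ e^{-tE} dμ < ∞`.  For `y₀ > 0` put `g(w) := ∫ e^{-(y₀ + w)E} cos(p y₁) dμ`: it is holomorphic on `|w| < y₀` by the tree's dominated
holomorphic parameter integral `Literature.Analysis.Complex.differentiableOn_integral_of_dominated` (near `w₀` the bound `e^{-RE}`,
`R = (y₀ - |w₀|)/2`, is `μ`-integrable), its real trace is `k(y₀ + u, y₁)`, and `‖g(w)‖ ≤ ∫ e^{-(y₀ + Re w)E} dμ = k(y₀ + Re w, 0)`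
(`|cos| ≤ 1`, the representation at `x = 0`).  For `y₀ < 0` use `w ↦ g(-w)` for `|y₀|` and the time reflection `θ₂ ∈ D₆`.

HONEST LABEL: R0 is the first (S–M) rung of an OPEN line; nothing about `PlanarConicChart`, `PlanarAnalyticOffZero`, the stubs
(C) `PlanarSpectralCone` / (A) `AngularContinuation` / `OddModeRigidity`, ⟨23035⟩, ⟨23125⟩, R2d or any summit is proved here; the
Yang–Mills mass gap is NOT proved; no summit is proved by a line.
-/

noncomputable section

open MeasureTheory Filter Topology Set
open scoped BigOperators

namespace Summit.QuantumFields.YangMills.Theorems.F4SubCurvatureDoorPlanarFrameTimeHolomorphyRegistered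

open Literature.MathematicalPhysics.QuantumLattice (timeReflection timeReflection_apply)
open Summit.QuantumFields.YangMills.Theorems.F4SubCurvatureDoorSliceDensityRegistered (E2)
open Summit.QuantumFields.YangMills.Theorems.F4SubCurvatureDoorSliceInClassRegistered (InPlanarClass)
open Summit.QuantumFields.YangMills.Theorems.F4SubCurvatureDoorPlanarLaplaceFourier

/-- The point `(a, b)` of the plane (same text as `Lines/angular_type.lean`'s `mk2`). [problem-side definition] -/
def mk2 (a b : ℝ) : E2 := (WithLp.equiv 2 (Fin 2 → ℝ)).symm ![a, b]

/-- **R0 · PlanarFrameTimeHolomorphy** (target, S–M; budget-free).  Complex translation along the frame-`0` time axis: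
for `k ∈ InPlanarClass` and `y` off the mirror `y₀ = 0`, `u ↦ k(y₀ + u, y₁)` extends holomorphically to the disc
`|u| < |y₀|`, with the axis bound `‖g(w)‖ ≤ k(y₀ + Re w, 0)` (OS contraction semigroup + Cauchy–Schwarz; for `y₀ < 0` use
the time reflection in `D₆`).  Frames `±60°` follow by `D₆`-invariance.
[target; sources: OsterwalderSchrader1973 §4, GlimmJaffe1987 Thm. 6.1.3; tree: MirrorSlabTranslationHolomorphy] -/
def PlanarFrameTimeHolomorphy : Prop :=
  ∀ k : E2 → ℝ, InPlanarClass k → ∀ y : E2, y 0 ≠ 0 →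
    ∃ g : ℂ → ℂ, DifferentiableOn ℂ g (Metric.ball (0 : ℂ) |y 0|) ∧
      (∀ u : ℝ, |u| < |y 0| → g u = k (mk2 (y 0 + u) (y 1))) ∧
      ∀ w ∈ Metric.ball (0 : ℂ) |y 0|, ‖g w‖ ≤ k (mk2 (y 0 + w.re) 0)

/-! ## The positive-time frame lemma -/

/-- **Complex time translation.**  For `k ∈ InPlanarClass` and `t₀, x₁ ∈ ℝ`: `u ↦ k(t₀ + u, x₁)` is on `(-t₀, t₀)` the trace of a
function holomorphic on the disc `|w| < t₀` and bounded there by `k(t₀ + Re w, 0)` (vacuous unless `t₀ > 0`). -/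
theorem frame_holomorphy_pos (k : E2 → ℝ) (hk : InPlanarClass k) (t₀ x₁ : ℝ) :
    ∃ g : ℂ → ℂ, DifferentiableOn ℂ g (Metric.ball (0 : ℂ) t₀) ∧
      (∀ u : ℝ, |u| < t₀ → g u = k (mk2 (t₀ + u) x₁)) ∧
      ∀ w ∈ Metric.ball (0 : ℂ) t₀, ‖g w‖ ≤ k (mk2 (t₀ + w.re) 0) := by
  obtain ⟨μ, hμsupp, hμ⟩ := exists_planarLF k hk
  -- the integrand and the candidate
  set F : ℂ → ℝ × ℝ → ℂ := fun w z =>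
    Complex.exp (-(((t₀ : ℂ) + w) * (z.1 : ℂ))) * ((Real.cos (z.2 * x₁) : ℝ) : ℂ) with hF
  have hFnorm : ∀ w z, ‖F w z‖ ≤ Real.exp (-((t₀ + w.re) * z.1)) := by
    intro w z
    simp only [hF, norm_mul, Complex.norm_exp, Complex.norm_real, Real.norm_eq_abs]
    have hre : (-(((t₀ : ℂ) + w) * (z.1 : ℂ))).re = -((t₀ + w.re) * z.1) := by
      simp [Complex.mul_re]
    rw [hre]
    exact mul_le_of_le_one_right (Real.exp_pos _).le (Real.abs_cos_le_one _)
  have hFcont : ∀ w, Continuous (F w) := fun w => by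
    simp only [hF]
    fun_prop
  have hFdiff : ∀ z, Differentiable ℂ fun w => F w z := fun z => by
    simp only [hF]
    fun_prop
  refine ⟨fun w => ∫ z, F w z ∂μ, ?_, ?_, ?_⟩
  · -- holomorphy: dominated holomorphic parameter integral
    refine Literature.Analysis.Complex.differentiableOn_integral_of_dominated
      (fun w _ => (hFcont w).aestronglyMeasurable)
      (Eventually.of_forall fun z => (hFdiff z).differentiableOn) ?_
    intro w₀ hw₀
    rw [Metric.mem_ball, dist_zero_right] at hw₀
    set R : ℝ := (t₀ - ‖w₀‖) / 2 with hR
    have hRpos : 0 < R := by rw [hR]; linarith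
    refine ⟨R, hRpos, ?_, fun z => Real.exp (-(R * z.1)), (hμ R hRpos).1, ?_⟩
    · intro w hw
      rw [Metric.mem_ball] at hw
      rw [Metric.mem_ball, dist_zero_right]
      have := norm_le_norm_add_norm_sub' w w₀
      rw [← dist_eq_norm] at this
      linarith
    · filter_upwards [ae_energy_nonneg hμsupp] with z hz w hw
      rw [Metric.mem_ball] at hw
      refine le_trans (hFnorm w z) (Real.exp_le_exp.2 ?_)
      have h1 : ‖w‖ < t₀ - R := by
        have := norm_le_norm_add_norm_sub' w w₀
        rw [← dist_eq_norm] at this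
        linarith
      have h2 : R ≤ t₀ + w.re := by
        have := Complex.abs_re_le_norm w
        rw [abs_le] at this
        linarith
      nlinarith
  · -- real trace
    intro u hu
    have hpos : 0 < t₀ + u := by
      rw [abs_lt] at hu
      linarith
    have hrepr := (hμ (t₀ + u) hpos).2 x₁
    simp only [mk2]
    rw [hrepr, ← integral_complex_ofReal]
    refine integral_congr_ae (ae_of_all _ fun z => ?_)
    simp only [hF]
    rw [mul_comm z.1 (t₀ + u)]
    push_cast
    all_goals ring_nf
  · -- the axis bound
    intro w hw
    rw [Metric.mem_ball, dist_zero_right] at hw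
    have hpos : 0 < t₀ + w.re := by
      have := Complex.abs_re_le_norm w
      rw [abs_le] at this
      linarith
    have hrepr := (hμ (t₀ + w.re) hpos).2 0
    simp only [mul_zero, Real.cos_zero, mul_one] at hrepr
    simp only [mk2]
    rw [hrepr]
    refine norm_integral_le_of_norm_le ?_ (ae_of_all _ fun z => ?_)
    · have h := (hμ (t₀ + w.re) hpos).1
      refine h.congr (ae_of_all _ fun z => ?_)
      simp only [mul_comm]
    · rw [mul_comm z.1]
      exact hFnorm w z

/-! ## The rung -/

/-- **RUNG R0 (by name): `PlanarFrameTimeHolomorphy`.** -/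
theorem planarFrameTimeHolomorphy : PlanarFrameTimeHolomorphy := by
  intro k hk y hy0
  have hθ : ∀ y, k (timeReflection 2 y) = k y := hk.2.2.1
  rcases lt_or_gt_of_ne hy0 with hneg | hpos
  · -- `y₀ < 0`: reflect the time axis
    obtain ⟨g, hg, hreal, hbound⟩ := frame_holomorphy_pos k hk (-y 0) (y 1)
    rw [abs_of_neg hneg]
    refine ⟨fun w => g (-w), ?_, ?_, ?_⟩
    · refine hg.comp differentiable_neg.differentiableOn fun w hw => ?_
      simpa [Metric.mem_ball] using hw
    · intro u hu
      have h := hreal (-u) (by rwa [abs_neg])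
      have e : k (mk2 (y 0 + u) (y 1)) = k (mk2 (-y 0 + -u) (y 1)) := by
        rw [← hθ (mk2 (y 0 + u) (y 1))]
        simp only [mk2]
        rw [timeReflection_mk, neg_add]
      rw [e, ← h]
      push_cast
      rfl
    · intro w hw
      have h := hbound (-w) (by simpa [Metric.mem_ball] using hw)
      have e : k (mk2 (y 0 + w.re) 0) = k (mk2 (-y 0 + (-w).re) 0) := by
        rw [← hθ (mk2 (y 0 + w.re) 0)]
        simp only [mk2]
        rw [timeReflection_mk, Complex.neg_re, neg_add]
      rw [e]
      exact h
  · -- `y₀ > 0`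
    rw [abs_of_pos hpos]
    exact frame_holomorphy_pos k hk (y 0) (y 1)

end Summit.QuantumFields.YangMills.Theorems.F4SubCurvatureDoorPlanarFrameTimeHolomorphyRegistered

end
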